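import Summits.BirchSwinnertonDyer.BirchSwinnertonDyer.Theorems.KolyvaginRoadThreePTDevissageTrivialHE
import Summits.BirchSwinnertonDyer.BirchSwinnertonDyer.Theorems.SchneiderFreeAdditiveX3PoitouTateMiddleExactSuperset
import Summits.BirchSwinnertonDyer.Rank1Residual.GaloisImage.SelmerGroupFinite
import Literature.NumberTheory.GaloisCohomology.ShaOneMuPrime
import HarnessLib

/-!
# Milne *ADT* I Thm. 4.10(b) `Ker γ¹ ⊆ Im β¹` for every 2-dimensional UNIPOTENT `𝔽ₚ`-module over a
# number field containing `μₚ` — UNCONDITIONAL (the instance of the dévissage)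

For a number field `K : Type` containing a primitive `p`-th root of unity (`p` odd, or `K` totally
complex), and a short exact sequence `0 → A →(f) M →(g) B → 0` of finite discrete `p`-torsion
`Γ_K`-modules with `A`, `B` TRIVIAL of order `p`: **Milne I Thm. 4.10(b) holds for `M` and THE invariant
maps `LocalInvariants.canonical K p` at EVERY admissible `S`** (`middleExact_canonical_of_unipotentTwo_all`).
The last two inputs of `middleExact_canonical_of_unipotentTwo` (the `H¹_{𝓤_S^*}`-vanishings) are
discharged for all LARGE `S` by the shrinking argument (as in `…PTDevissageShrinking`) fed with
the FINITENESS of Selmer groups of finite modules (n1011's `finite_selmerGroup_of_isUnramifiedOutside`,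
Milne I §4 / NSW (8.3.20)) and `Ш¹ = 0` for a trivial module of prime order over `K ∋ μₚ`
(`sha_one_eq_zero_of_trivial_of_card_eq`, from the tree's `Ш¹(K, μₚ) = 0`,
`sha_mu_primePow_eq_bot_of_isPrimitiveRoot`); the passage to every admissible `S` is door-c6 g7's
`middleExact_canonical_of_superset`.  This is the module shape of `E[p]|_{K'}` over the fixed field `K'`
of a `p`-Sylow of `Gal(K(E[p])/K)` — the instance the PT stub of crux `ZhangSharpFrameAtThreeHL` needs
after the prime-to-`p` descent (not in the tree).  Theorems only; no case of BSD.

References: [MilneADT2006] I Thm. 4.10(b), Lemma 4.8; [NeukirchSchmidtWingberg2008] (8.3.20);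
[Harari2020] Thm. 18.9.
-/

noncomputable section

open CategoryTheory Function NumberField IsDedekindDomain
open scoped NumberField ContRepresentation

set_option linter.dupNamespace false
set_option autoImplicit false

namespace Summit.BirchSwinnertonDyer.BirchSwinnertonDyer.Theorems.KolyvaginRoadThreePT

open Field
open Literature.NumberTheory.GaloisRepresentations Literature.NumberTheory.GaloisCohomology
open Literature.NumberTheory.GaloisRepresentations.DiscreteGaloisModule (mu MuCarrier TateDual tateDual
  localTatePairingZMod homOfIntertwining unramifiedSubgroup SelmerStructure)
open _root_.TopRep _root_.ContRepresentation _root_.ContinuousCohomology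
open Summit.BirchSwinnertonDyer.BirchSwinnertonDyer.Theorems.SchneiderFreeAdditiveX3.PoitouTateReduction
open Summit.BirchSwinnertonDyer.Rank1Residual.GaloisImage.SelmerFinite

/-! ## §1. `Ш¹(K, X) = 0` for a trivial module of prime order over `K ∋ μₚ` -/

section ShaOne

variable {K : Type} [Field K] [NumberField K] {p : ℕ} [hp : Fact p.Prime]
variable {X Y : Type} [AddCommGroup X] [TopologicalSpace X] [DiscreteTopology X]
  [AddCommGroup Y] [TopologicalSpace Y] [DiscreteTopology Y]

omit [NumberField K] in
/-- `H¹(ψ) (H¹(φ) y) = y` when `ψ ∘ φ = id` (degree one). [folklore] -/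
theorem galoisCohomology.map_one_map_one_eq_self_of_comp_eq {ρX : DiscreteGaloisModule K X}
    {ρY : DiscreteGaloisModule K Y} (φ : ρX.toContRepresentation →ⁱL ρY.toContRepresentation)
    (ψ : ρY.toContRepresentation →ⁱL ρX.toContRepresentation) (hψφ : ∀ x : X, ψ (φ x) = x)
    (y : galoisCohomology ρX 1) : galoisCohomology.map ψ 1 (galoisCohomology.map φ 1 y) = y := by
  obtain ⟨c, rfl⟩ := oneCocycleClass_surjective ρX.toTopRep y
  rw [galoisCohomology.map_one_oneCocycleClass, galoisCohomology.map_one_oneCocycleClass]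
  refine congrArg _ (Subtype.ext (ContinuousMap.ext fun σ => ?_))
  exact hψφ _

/-- **`Ш¹(K, X) = 0` for a trivial module `X` of prime order `p` over a number field containing a
primitive `p`-th root of unity**: `X ≅ μₚ` as Galois modules and `Ш¹(K, μₚ) = 0`
(`sha_mu_primePow_eq_bot_of_isPrimitiveRoot`, Harari Thm. 18.9 / Grunwald–Wang, prime level).
[cite: Harari2020, Thm. 18.9] [cite: MilneADT2006, Ch. I, Thm. 4.10] -/
theorem sha_one_eq_zero_of_trivial_of_card_eq {ζ : K} (hζ : IsPrimitiveRoot ζ p)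
    (ρX : DiscreteGaloisModule K X) (hX : ∀ (σ : absoluteGaloisGroup K) (x : X), ρX σ x = x)
    (hcard : Nat.card X = p) (y : galoisCohomology ρX 1)
    (hy : ∀ v : Place K, galoisCohomology.localization ρX v 1 y = 0) : y = 0 := by
  haveI : NeZero (p ^ 1) := ⟨pow_ne_zero 1 hp.out.ne_zero⟩
  have hζ1 : IsPrimitiveRoot ζ (p ^ 1) := by rwa [pow_one]
  have hμ : ∀ (σ : absoluteGaloisGroup K) (w : MuCarrier K (p ^ 1)), mu K (p ^ 1) σ w = w :=
    mu_apply_eq_self_of_isPrimitiveRoot K hζ1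
  have hcardμ : Nat.card (MuCarrier K (p ^ 1)) = p :=
    (HasEnoughRootsOfUnity.natCard_rootsOfUnity (AlgebraicClosure K) (p ^ 1)).trans (pow_one p)
  let e : X ≃+ MuCarrier K (p ^ 1) := addEquivOfPrimeCardEq hcard hcardμ
  obtain ⟨φ, hφ⟩ := exists_intertwining_of_trivial ρX (mu K (p ^ 1)) hX hμ e.toAddMonoidHom
  obtain ⟨ψ, hψ⟩ := exists_intertwining_of_trivial (mu K (p ^ 1)) ρX hμ hX e.symm.toAddMonoidHom
  have hψφ : ∀ x : X, ψ (φ x) = x := fun x => by rw [hψ, hφ]; exact e.symm_apply_apply x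
  have hsha := sha_mu_primePow_eq_bot_of_isPrimitiveRoot K hp.out 1 hζ1
  have hmem : galoisCohomology.map φ 1 y ∈ DiscreteGaloisModule.sha (mu K (p ^ 1)) := by
    rw [DiscreteGaloisModule.mem_sha_iff]
    intro v
    rw [localization_map_one' φ v y, hy v]
    exact map_zero _
  rw [hsha, AddSubgroup.mem_bot] at hmem
  rw [← galoisCohomology.map_one_map_one_eq_self_of_comp_eq φ ψ hψφ y, hmem, map_zero]

/-- **The `H¹_{𝓤_S^*}`-vanishing for a trivial module of prime order over `K ∋ μₚ`, for all large `S`**: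
there is a finite `S₀ ⊇ S₁` such that for every finite `S ⊇ S₀`, every class of `H¹(K, X)` zero on `S`
and unramified off `S` is zero (shrinking lemma + finiteness of the Selmer group of the structure
`(⊤ on S₁, unramified off S₁)` + `Ш¹(K, X) = 0`). [cite: MilneADT2006, Ch. I §4, Lemma 4.8]
[cite: NeukirchSchmidtWingberg2008, (8.3.20)] -/
theorem exists_finset_h1_eq_zero_of_trivial [Finite X] {ζ : K} (hζ : IsPrimitiveRoot ζ p)
    (ρX : DiscreteGaloisModule K X) (hX : ∀ (σ : absoluteGaloisGroup K) (x : X), ρX σ x = x)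
    (hcard : Nat.card X = p) (S₁ : Finset (Place K))
    (hinf : ∀ w : InfinitePlace K, (Sum.inl w : Place K) ∈ S₁) :
    ∃ S₀ : Finset (Place K), S₁ ⊆ S₀ ∧ ∀ S : Finset (Place K), S₀ ⊆ S →
      ∀ y : galoisCohomology ρX 1,
        (∀ v ∈ S, galoisCohomology.localization ρX v 1 y = 0) →
        (∀ w : HeightOneSpectrum (𝓞 K), (Sum.inr w : Place K) ∉ S →
          galoisCohomology.localization ρX (Sum.inr w) 1 y ∈ unramifiedSubgroup (GaloisRep.toLocal w ρX) 1) →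
        y = 0 := by
  classical
  -- the structure `(⊤ on S₁, unramified off S₁)` and the finiteness of its Selmer group
  let 𝓤 : SelmerStructure ρX := fun v =>
    match v with
    | Sum.inl _ => ⊤
    | Sum.inr w => if (Sum.inr w : Place K) ∈ S₁ then ⊤ else unramifiedSubgroup (GaloisRep.toLocal w ρX) 1
  have h𝓤nS : ∀ w : HeightOneSpectrum (𝓞 K), (Sum.inr w : Place K) ∉ S₁ →
      𝓤 (Sum.inr w) = unramifiedSubgroup (GaloisRep.toLocal w ρX) 1 := fun w hw => by
    change (if (Sum.inr w : Place K) ∈ S₁ then ⊤ else unramifiedSubgroup (GaloisRep.toLocal w ρX) 1) = _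
    rw [if_neg hw]
  have h𝓤S : ∀ v : Place K, v ∈ S₁ → 𝓤 v = ⊤ := fun v hv => by
    rcases v with w | w
    · rfl
    · change (if (Sum.inr w : Place K) ∈ S₁ then ⊤ else unramifiedSubgroup (GaloisRep.toLocal w ρX) 1) = _
      rw [if_pos hv]
      rfl
  have hur : ∀ v : HeightOneSpectrum (𝓞 K), (Sum.inr v : Place K) ∉ S₁ → GaloisRep.IsUnramifiedAt v ρX := by
    intro v _
    rw [GaloisRep.isUnramifiedAt_iff_toLocal_holds]
    intro σ _
    exact DFunLike.ext _ _ fun a => hX _ a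
  haveI hfin : Finite 𝓤.selmerGroup := finite_selmerGroup_of_isUnramifiedOutside ρX hur ⟨hinf, h𝓤nS⟩
  -- every class zero on `S ⊇ S₁` and unramified off `S` lies in the finite group `H¹_𝓤`
  have hU : ∀ (S : Finset (Place K)), S₁ ⊆ S → ∀ y : galoisCohomology ρX 1,
      (∀ v ∈ S, galoisCohomology.localization ρX v 1 y = 0) →
      (∀ w : HeightOneSpectrum (𝓞 K), (Sum.inr w : Place K) ∉ S →
        galoisCohomology.localization ρX (Sum.inr w) 1 y ∈ unramifiedSubgroup (GaloisRep.toLocal w ρX) 1) →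
      y ∈ 𝓤.selmerGroup := by
    intro S hS y hyS hyur
    rw [SelmerStructure.mem_selmerGroup_iff]
    intro v
    by_cases hv : v ∈ S₁
    · rw [h𝓤S v hv]; exact AddSubgroup.mem_top _
    · rcases v with w | w
      · exact absurd (hinf w) hv
      · rw [h𝓤nS w hv]
        by_cases hwS : (Sum.inr w : Place K) ∈ S
        · rw [hyS _ hwS]; exact zero_mem _
        · exact hyur w hwS
  -- a detecting place for every non-zero element of `H¹_𝓤` (`Ш¹ = 0`)
  have hdet : ∀ u : galoisCohomology ρX 1, ∃ v : Place K,
      u ≠ 0 → galoisCohomology.localization ρX v 1 u ≠ 0 := by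
    intro u
    by_cases h : ∀ v : Place K, galoisCohomology.localization ρX v 1 u = 0
    · exact ⟨Sum.inl (Classical.arbitrary (InfinitePlace K)),
        fun hne => (hne (sha_one_eq_zero_of_trivial_of_card_eq hζ ρX hX hcard u h)).elim⟩
    · simp only [not_forall] at h
      obtain ⟨v, hv⟩ := h
      exact ⟨v, fun _ => hv⟩
  choose d hd using hdet
  let U : Finset (galoisCohomology ρX 1) := (Set.toFinite (𝓤.selmerGroup : Set (galoisCohomology ρX 1))).toFinset
  refine ⟨S₁ ∪ U.image d, Finset.subset_union_left, fun S hS y hyS hyur => ?_⟩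
  have hyU : y ∈ 𝓤.selmerGroup := hU S (fun v hv => hS (Finset.mem_union_left _ hv)) y hyS hyur
  by_contra hy0
  have hyU' : y ∈ U := (Set.toFinite _).mem_toFinset.2 hyU
  have hdS : d y ∈ S := hS (Finset.mem_union_right _ (Finset.mem_image_of_mem d hyU'))
  exact hd y hy0 (hyS _ hdS)

end ShaOne

/-! ## §2. The unconditional instance -/

section Instance

variable {K : Type} [Field K] [NumberField K] {p : ℕ} [hp : Fact p.Prime]
variable {A M B : Type}
  [AddCommGroup A] [TopologicalSpace A] [DiscreteTopology A] [Finite A]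
  [AddCommGroup M] [TopologicalSpace M] [DiscreteTopology M] [Finite M]
  [AddCommGroup B] [TopologicalSpace B] [DiscreteTopology B] [Finite B]

/-- **Milne I Thm. 4.10(b) for every 2-dimensional UNIPOTENT `𝔽ₚ`-module over `K ∋ μₚ`, THE invariant
maps, EVERY admissible `S` — unconditional** (see the module docstring).
[cite: MilneADT2006, Ch. I, Thm. 4.10(b)] [cite: NeukirchSchmidtWingberg2008, (8.3.20)] -/
theorem middleExact_canonical_of_unipotentTwo_all [Finite (TateDual K B p)]
    (harch : ∀ w : InfinitePlace K, w.IsReal → Odd p) {ζ : K} (hζ : IsPrimitiveRoot ζ p)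
    (ρA : DiscreteGaloisModule K A) (ρ : DiscreteGaloisModule K M) (ρB : DiscreteGaloisModule K B)
    (hA : ∀ (σ : absoluteGaloisGroup K) (a : A), ρA σ a = a)
    (hB : ∀ (σ : absoluteGaloisGroup K) (b : B), ρB σ b = b)
    (hcardA : Nat.card A = p) (hcardB : Nat.card B = p)
    (hpA : ∀ a : A, p • a = 0) (hpM : ∀ m : M, p • m = 0) (hpB : ∀ b : B, p • b = 0)
    {f : ρA.toContRepresentation →ⁱL ρ.toContRepresentation}
    {g : ρ.toContRepresentation →ⁱL ρB.toContRepresentation}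
    (h : IsSES (homOfIntertwining f) (homOfIntertwining g))
    {S : Finset (Place K)} (hSinf : ∀ w : InfinitePlace K, (Sum.inl w : Place K) ∈ S)
    (hS : ∀ v : HeightOneSpectrum (𝓞 K), (Sum.inr v : Place K) ∉ S →
      ((p : ℕ) : 𝓞 K) ∉ v.asIdeal ∧ GaloisRep.IsUnramifiedAt v ρ)
    (t : Π v : Place K, galoisCohomology (ρ.toLocal v) 1)
    (horth : ∀ y : galoisCohomology (ρ.tateDual p) 1,
      (∀ v : HeightOneSpectrum (𝓞 K), (Sum.inr v : Place K) ∉ S →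
        galoisCohomology.localization (ρ.tateDual p) (Sum.inr v) 1 y ∈
          unramifiedSubgroup (GaloisRep.toLocal v (ρ.tateDual p)) 1) →
      ∑ v ∈ S, localTatePairingZMod ρ p v (LocalInvariants.canonical K p v) (t v)
        (galoisCohomology.localization (ρ.tateDual p) v 1 y) = 0) :
    ∃ x : galoisCohomology ρ 1,
      (∀ v : HeightOneSpectrum (𝓞 K), (Sum.inr v : Place K) ∉ S →
        galoisCohomology.localization ρ (Sum.inr v) 1 x ∈ unramifiedSubgroup (GaloisRep.toLocal v ρ) 1) ∧
      ∀ v ∈ S, galoisCohomology.localization ρ v 1 x = t v := by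
  classical
  haveI : NeZero p := ⟨hp.out.ne_zero⟩
  have hμ : ∀ (σ : absoluteGaloisGroup K) (w : MuCarrier K p), mu K p σ w = w :=
    mu_apply_eq_self_of_isPrimitiveRoot K hζ
  -- the two trivial modules `A^D`, `B^{DD}` of order `p`
  have hAD : ∀ (σ : absoluteGaloisGroup K) (φ : TateDual K A p), ρA.tateDual p σ φ = φ :=
    tateDual_apply_eq_self_of_trivial p ρA hA hμ
  have hcardAD : Nat.card (TateDual K A p) = p := (HomCarrier.natCard_eq (muEquivZMod K p) hpA).trans hcardA
  have hBD : ∀ (σ : absoluteGaloisGroup K) (φ : TateDual K B p), ρB.tateDual p σ φ = φ :=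
    tateDual_apply_eq_self_of_trivial p ρB hB hμ
  have hpBD : ∀ φ : TateDual K B p, p • φ = 0 := fun φ => DiscreteGaloisModule.TateDual.nsmul_eq_zero φ
  have hcardBD : Nat.card (TateDual K B p) = p := (HomCarrier.natCard_eq (muEquivZMod K p) hpB).trans hcardB
  have hBDD : ∀ (σ : absoluteGaloisGroup K) (φ : TateDual K (TateDual K B p) p),
      (ρB.tateDual p).tateDual p σ φ = φ := tateDual_apply_eq_self_of_trivial p (ρB.tateDual p) hBD hμ
  have hcardBDD : Nat.card (TateDual K (TateDual K B p) p) = p :=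
    (HomCarrier.natCard_eq (muEquivZMod K p) hpBD).trans hcardBD
  haveI : Finite (TateDual K A p) := DiscreteGaloisModule.TateDual.finite K A p
  haveI : Finite (TateDual K (TateDual K B p) p) := DiscreteGaloisModule.TateDual.finite K (TateDual K B p) p
  -- the large sets of places
  obtain ⟨S₁, hSS₁, hS₁⟩ := exists_finset_h1_eq_zero_of_trivial hζ (ρA.tateDual p) hAD hcardAD S hSinf
  obtain ⟨S₂, hSS₂, hS₂⟩ := exists_finset_h1_eq_zero_of_trivial hζ ((ρB.tateDual p).tateDual p) hBDD hcardBDD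
    S hSinf
  -- Milne I 4.10(b) at `S' = S₁ ∪ S₂`, then at `S`
  have hSS' : S ⊆ S₁ ∪ S₂ := fun v hv => Finset.mem_union_left _ (hSS₁ hv)
  have h1S' : S₁ ⊆ S₁ ∪ S₂ := Finset.subset_union_left
  have h2S' : S₂ ⊆ S₁ ∪ S₂ := Finset.subset_union_right
  have hS' : ∀ v : HeightOneSpectrum (𝓞 K), (Sum.inr v : Place K) ∉ S₁ ∪ S₂ →
      ((p : ℕ) : 𝓞 K) ∉ v.asIdeal ∧ GaloisRep.IsUnramifiedAt v ρ := fun v hv => hS v fun h' => hv (hSS' h')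
  -- unramifiedness of the trivial pieces, the dual maps
  have hurA : ∀ v : HeightOneSpectrum (𝓞 K), GaloisRep.IsUnramifiedAt v ρA := fun v => by
    rw [GaloisRep.isUnramifiedAt_iff_toLocal_holds]
    intro σ _
    exact DFunLike.ext _ _ fun a => hA _ a
  have hurB : ∀ v : HeightOneSpectrum (𝓞 K), GaloisRep.IsUnramifiedAt v ρB := fun v => by
    rw [GaloisRep.isUnramifiedAt_iff_toLocal_holds]
    intro σ _
    exact DFunLike.ext _ _ fun b => hB _ b
  obtain ⟨gD, hgD⟩ := exists_tateDual_precomp_intertwining p g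
  obtain ⟨fD, hfD⟩ := exists_tateDual_precomp_intertwining p f
  refine middleExact_canonical_of_superset ρ hpM hSS' hSinf hS ?_ t horth
  intro t' horth'
  have hSinf' : ∀ w : InfinitePlace K, (Sum.inl w : Place K) ∈ S₁ ∪ S₂ := fun w => hSS' (hSinf w)
  have hS'' : ∀ v : HeightOneSpectrum (𝓞 K), (Sum.inr v : Place K) ∉ S₁ ∪ S₂ →
      ((p : ℕ) : 𝓞 K) ∉ v.asIdeal ∧ GaloisRep.IsUnramifiedAt v ρA ∧ GaloisRep.IsUnramifiedAt v ρ ∧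
        GaloisRep.IsUnramifiedAt v ρB := fun v hv => ⟨(hS' v hv).1, hurA v, (hS' v hv).2, hurB v⟩
  exact middleExact_canonical_of_extension h hpA hpM gD hgD fD hfD hSinf' hS''
    (fun S'' hSS'' t'' horth'' => middleExact_canonical_of_trivial_of_card_eq harch ρA hA hcardA S''
      (fun w => hSS'' (hSinf' w)) (fun v hv => (hS' v fun h' => hv (hSS'' h')).1) t'' horth'')
    (fun t'' horth'' => middleExact_canonical_of_trivial_of_card_eq harch ρB hB hcardB (S₁ ∪ S₂) hSinf'
      (fun v hv => (hS' v hv).1) t'' horth'')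
    (fun S'' hSS'' t'' horth'' => middleExact_canonical_of_trivial_of_card_eq harch (ρB.tateDual p) hBD hcardBD
      S'' (fun w => hSS'' (hSinf' w)) (fun v hv => (hS' v fun h' => hv (hSS'' h')).1) t'' horth'')
    (sha_two_eq_zero_of_trivial_of_card_eq hζ ρA hA hcardA)
    (sha_two_tateDual_eq_zero_of_trivial_of_card_eq hζ ρB hB hpB hcardB)
    (hS₁ (S₁ ∪ S₂) h1S') (hS₂ (S₁ ∪ S₂) h2S') t' horth'

end Instance

end Summit.BirchSwinnertonDyer.BirchSwinnertonDyer.Theorems.KolyvaginRoadThreePT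

end
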